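import Summits.AtomisticToContinuum.HydrodynamicLimit.Theorems.ImplosionDichotomyHydroLimitInBandBandShiftStaticsPrelim
import Summits.AtomisticToContinuum.HydrodynamicLimit.Theorems.ImplosionDichotomyHydroLimitInBandSignedBandDefs
import HarnessLib

/-!
# The re-orthogonalised band truncation of the suprathermal heat-flux remainder (stub
# `stub_bandShiftStatics`, line `IdeatorOneSketch`, crux `HydroLimitInBand`,
# stmt-AtomisticToContinuum-9133)

Helper file (`--supports stmt-AtomisticToContinuum-9133`) proving the registered stub
`stub_bandShiftStatics : BandShiftStatics` of skeleton v16 of the line (statement in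
`…HydroLimitInBandSignedBandDefs.lean`; Gaussian preliminaries in helper file A
`…BandShiftStaticsPrelim.lean`). Static Gaussian analysis, no dynamics.

For globally continuous families `θ ∈ [θm, θM]`, `‖u‖ ≤ U`, `‖b‖ ≤ Bb` and a bounded continuous
cut-off profile `G` with `G(x,s) = s − 5θ` for `s ≤ 1` and `(b·w)G ⊥ v_k` under the local
Maxwellian, the suprathermal remainder `hi = (b·w) R(x,|w|²)`, `R = s − 5θ − G`, `w = v − u`, is
split at the level `L = K₁²` as `hi = F_b + ((b·w) R (1 − χ_L)(|w|²) + ρ (b·w) ω₀(|w|²/θ))` with the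
BOUNDED odd class member `F_b = (b·w) G_b(x,|w|²)`,

  `G_b(x,s) = R(x,s) χ_L(s) − ρ(x) ω₀(s/θ(x))`, `χ_L(s) = min 1 (max 0 (2 − s/L))`,
  `ω₀(t) = max 0 (1 − |t − 1|)`, `ρ = E[ξ₀² Rχ_L(θ‖ξ‖²)] / m₀`, `m₀ = E[ξ₀² ω₀(‖ξ‖²)] > 0`,

of growth `≤ C_B K₁ (1 + |v|²)` (`C_B` independent of `K₁`: `|Rχ_L(|w|²)| ≤ C_R |w|² 1{|w| ≤ 2K₁}`,
`C_R = 1 + 5θM + C_G`) and orthogonal to `1, v_k, |v|²` (`ClampedCurrentsDockCutoff.odd_member_orth`: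
the three conditions are the one scalar identity `E[ξ₀² G_b(x, θ‖ξ‖²)] = ρ m₀ − ρ m₀ = 0`). The top
`(b·w)R(1 − χ_L)` lives on `{|w| > K₁}` and is `≤ Bb C_R |w|³` there; the correction is
super-exponentially small, `|ρ (b·w) ω₀| ≤ A e^{−cK₁}` for `K₁ ≥ K₀ = max 1 (cθM/a)`: by momentum
orthogonality and Wick (`bandShift_normMoment`) `‖b‖ E[ξ₀² R(θ‖ξ‖²)] = 0`, so
`‖b‖ ρ m₀ = −‖b‖ E[ξ₀² R(1−χ_L)(θ‖ξ‖²)]` is a Gaussian tail `≤ Bb T e^{−aK₁²/θM}`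
(`tail_moment_bound`, Fernique's constant `2a`).

References: B. Nachtergaele, H.-T. Yau, Comm. Math. Phys. 243 (2003) §5 (momentum truncation of the
energy current); H.-T. Yau, Lett. Math. Phys. 22 (1991) §2.
-/

noncomputable section

namespace Summit.AtomisticToContinuum.HydrodynamicLimit.Theorems.HydroLimitInBandBandShift

open MeasureTheory Filter Set Topology
open Literature.MathematicalPhysics.KineticTheory Literature.Analysis.FluidPDE Literature.Analysis.FunctionSpaces
open ProbabilityTheory
open Summit.AtomisticToContinuum.HydrodynamicLimit.Theorems.KineticCurrentsWindowLDUniformSketch.ClassTruncation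
open Summit.AtomisticToContinuum.HydrodynamicLimit.Theorems.ClampedCurrentsDockCutoff
open Summit.AtomisticToContinuum.HydrodynamicLimit.Theorems.HydroLimitInBandSignedBand (BandShiftStatics)

/-! ## The construction over a parameter space -/

-- one long assembly proof (a dozen `set`/`obtain` constants and some forty intermediate facts) needs
-- more than the default 200000 heartbeats (it elaborates with 300000, not with 250000); 400000
-- leaves a margin
set_option maxHeartbeats 400000 in
/-- **The signed band truncation over a first-countable parameter space.** For a continuous
`θ : X → ℝ` with `0 < θm ≤ θ ≤ θM`, fields `u b : X → V3` with `‖u‖ ≤ U`, `‖b‖ ≤ Bb`, and a continuous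
cut-off profile `G(p,s)`, `|G| ≤ C_G` on `s ≥ 0`, `G(p,s) = s − 5θ(p)` for `s ≤ 1`, with
`(b·w)G(p,|w|²) ⊥ v_k` under `M_{1,u(p),θ(p)}`: there is `C_B ≥ 1` such that for every rate `c > 0`
there are `A ≥ 0`, `K₀ ≥ 1` such that every level `K₁ ≥ K₀` admits a continuous profile `G_b` with
`(b·w)G_b(p,|w|²)` bounded, of growth `≤ C_B K₁(1+|v|²)`, orthogonal to `1, v_k, |v|²`, and
`|(b·w)(|w|² − 5θ − G) − (b·w)G_b| ≤ Bb (1 + 5θM + C_G) 1{K₁ < |w|}|w|³ + A e^{−cK₁}`. Construction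
`G_b = Rχ_L − ρ ω₀(·/θ)`, `L = K₁²` (module docstring). [cite: NachtergaeleYau2003, §5] -/
theorem bandShift_param {X : Type*} [TopologicalSpace X] [FirstCountableTopology X]
    {θ : X → ℝ} (hθc : Continuous θ) (u b : X → V3) {G : X × ℝ → ℝ} (hGc : Continuous G)
    {θm θM U Bb C_G : ℝ} (hθm0 : 0 < θm) (hθmM : θm ≤ θM) (hBb0 : 0 ≤ Bb)
    (hCG0 : 0 ≤ C_G) (hθm : ∀ p, θm ≤ θ p) (hθM : ∀ p, θ p ≤ θM) (hU : ∀ p, ‖u p‖ ≤ U)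
    (hBb : ∀ p, ‖b p‖ ≤ Bb) (hGbd : ∀ p s, 0 ≤ s → |G (p, s)| ≤ C_G)
    (hGlo : ∀ p s, s ≤ 1 → G (p, s) = s - 5 * θ p)
    (hGorth : ∀ p (k : Fin 3), ∫ v, ((∑ j, b p j * (v - u p) j) * G (p, ‖v - u p‖ ^ 2)) * v k *
      localMaxwellian 1 (θ p) (u p) v = 0) :
    ∃ CB : ℝ, 1 ≤ CB ∧ ∀ c : ℝ, 0 < c → ∃ A : ℝ, 0 ≤ A ∧ ∃ K₀ : ℝ, 1 ≤ K₀ ∧ ∀ K₁ : ℝ, K₀ ≤ K₁ →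
      ∃ Gb : X × ℝ → ℝ, Continuous Gb ∧
        (∃ M : ℝ, ∀ p v, |(∑ j, b p j * (v - u p) j) * Gb (p, ‖v - u p‖ ^ 2)| ≤ M) ∧
        (∀ p v, |(∑ j, b p j * (v - u p) j) * Gb (p, ‖v - u p‖ ^ 2)| ≤
          CB * K₁ * (1 + ‖v‖ ^ 2)) ∧
        (∀ p, ∫ v, ((∑ j, b p j * (v - u p) j) * Gb (p, ‖v - u p‖ ^ 2)) *
          localMaxwellian 1 (θ p) (u p) v = 0) ∧
        (∀ p (k : Fin 3), ∫ v, ((∑ j, b p j * (v - u p) j) * Gb (p, ‖v - u p‖ ^ 2)) * v k *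
          localMaxwellian 1 (θ p) (u p) v = 0) ∧
        (∀ p, ∫ v, ((∑ j, b p j * (v - u p) j) * Gb (p, ‖v - u p‖ ^ 2)) * ‖v‖ ^ 2 *
          localMaxwellian 1 (θ p) (u p) v = 0) ∧
        (∀ p v, |(∑ j, b p j * (v - u p) j) *
              (‖v - u p‖ ^ 2 - 5 * θ p - G (p, ‖v - u p‖ ^ 2)) -
            (∑ j, b p j * (v - u p) j) * Gb (p, ‖v - u p‖ ^ 2)| ≤
          Bb * (1 + 5 * θM + C_G) * (if K₁ < ‖v - u p‖ then ‖v - u p‖ ^ 3 else 0) +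
            A * Real.exp (-(c * K₁))) := by
  have hθpos : ∀ p, 0 < θ p := fun p => hθm0.trans_le (hθm p)
  have hθM0 : 0 < θM := hθm0.trans_le hθmM
  /- Step 0: the remainder profile `R = s − 5θ − G` vanishes on `s ≤ 1` and `|R| ≤ C_R s` on `s ≥ 0`. -/
  set C_R : ℝ := 1 + 5 * θM + C_G with hC_R
  have hC_R0 : 0 ≤ C_R := by positivity
  have hRbd : ∀ p s, 0 ≤ s → |s - 5 * θ p - G (p, s)| ≤ C_R * s := by
    intro p s hs
    by_cases h1 : s ≤ 1
    · rw [hGlo p s h1, sub_self, abs_zero]; positivity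
    · have h1' : 1 ≤ s := (not_le.1 h1).le
      have hG' := abs_le.1 (hGbd p s hs)
      have hθ' := hθM p
      have hθ0 := hθpos p
      rw [abs_le]
      constructor <;> nlinarith [mul_nonneg (sub_nonneg.2 h1') hθM0.le,
        mul_nonneg (sub_nonneg.2 h1') hCG0]
  /- Step 1: Fernique's constant and the Gaussian tail constant; the tent `ω₀` (support `[0,2]`) and
  the reference moment `m₀ = E[ξ₀² ω₀(‖ξ‖²)] > 0` (the standard Gaussian charges open sets). -/
  obtain ⟨a, ha, Tt, hTt0, htail⟩ : ∃ a : ℝ, 0 < a ∧ ∃ Tt : ℝ, 0 ≤ Tt ∧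
      ∀ (p : X) (L : ℝ) (ω : ℝ → ℝ), (∀ s, 0 ≤ s → |ω s| ≤ C_R * s) → (∀ s, s ≤ L → ω s = 0) →
        |∫ ξ, ξ 0 * ξ 0 * ω (θ p * ‖ξ‖ ^ 2) ∂stdGaussian V3| ≤ Tt * Real.exp (-(a * L / θM)) := by
    obtain ⟨a₂, ha₂, hi⟩ := IsGaussian.exists_integrable_exp_sq (stdGaussian V3)
    have hexp : Integrable (fun ξ : V3 => Real.exp (2 * (a₂ / 2) * ‖ξ‖ ^ 2)) (stdGaussian V3) := by
      have e : 2 * (a₂ / 2) = a₂ := by ring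
      simpa only [e] using hi
    exact ⟨a₂ / 2, by positivity, _, by positivity, fun p L ω hω hω0 =>
      tail_moment_bound (by positivity) hexp (hθpos p) (hθM p) hC_R0 hω hω0⟩
  set ω₀ : ℝ → ℝ := fun t => max 0 (1 - |t - (0 + 1)|) with hω₀
  obtain ⟨hω₀c, hω₀0, hω₀1, -, hω₀hi, hω₀one⟩ := tent_props 0 (r := ω₀) fun t => by rw [hω₀]
  clear_value ω₀
  rw [zero_add] at hω₀one
  have hω₀abs : ∀ t, 0 ≤ t → |ω₀ t| ≤ 1 * (1 + t) := fun t ht =>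
    le_mul_one_add (by rw [abs_of_nonneg (hω₀0 t)]; exact hω₀1 t) zero_le_one ht
  have hiω₀ : Integrable (fun ξ : V3 => ξ 0 * ξ 0 * ω₀ (‖ξ‖ ^ 2)) (stdGaussian V3) :=
    integrable_coord_mul_weight 0 0 hω₀c hω₀abs
  set m₀ : ℝ := ∫ ξ, ξ 0 * ξ 0 * ω₀ (‖ξ‖ ^ 2) ∂stdGaussian V3 with hm₀def
  have hm₀ : 0 < m₀ := by
    haveI := isOpenPosMeasure_stdGaussian_V3
    have hpt : (EuclideanSpace.single (0 : Fin 3) (1 : ℝ) : V3) 0 = 1 := by simp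
    have hn : ‖(EuclideanSpace.single (0 : Fin 3) (1 : ℝ) : V3)‖ ^ 2 = 1 := by
      rw [PiLp.norm_single, norm_one, one_pow]
    rw [hm₀def]
    refine integral_pos_of_integrable_nonneg_nonzero
      (x := (EuclideanSpace.single (0 : Fin 3) (1 : ℝ) : V3)) (by fun_prop) hiω₀
      (fun ξ => mul_nonneg (mul_self_nonneg _) (hω₀0 _)) ?_
    beta_reduce
    rw [hpt, hn, hω₀one]
    norm_num
  clear_value m₀
  /- Step 2: `‖b‖ · E[ξ₀² R(p, θ‖ξ‖²)] = 0` (momentum orthogonality of `(b·w)G` and Wick). -/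
  have hbR : ∀ p, ‖b p‖ * ∫ ξ, ξ 0 * ξ 0 *
      (θ p * ‖ξ‖ ^ 2 - 5 * θ p - G (p, θ p * ‖ξ‖ ^ 2)) ∂stdGaussian V3 = 0 := fun p =>
    norm_mul_fluxMoment_eq_zero (hθpos p) (u p) (b p) (Gx := fun s => G (p, s)) (by fun_prop)
      (fun s hs => hGbd p s hs) (hGorth p)
  /- Step 3: the constants `C_B`, `A`, `K₀`. -/
  set S_ω : ℝ := (0 + 2) * θM with hS_ω
  have hS_ω0 : 0 ≤ S_ω := by positivity
  set A : ℝ := Bb * Tt * (1 + S_ω) / m₀ with hA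
  have hA0 : 0 ≤ A := by positivity
  refine ⟨4 * Bb * C_R * (1 + U ^ 2) + A + 1, le_add_of_nonneg_left (by positivity), fun c hc =>
    ⟨A, hA0, max 1 (c * θM / a), le_max_left _ _, fun K₁ hK₁ => ?_⟩⟩
  have hK₁1 : 1 ≤ K₁ := (le_max_left _ _).trans hK₁
  have hK₁0 : 0 < K₁ := one_pos.trans_le hK₁1
  have hcK : c * θM / a ≤ K₁ := (le_max_right _ _).trans hK₁
  /- Step 4: the cutoff `χ_L`, `L = K₁²` (`= 1` on `s ≤ L`, `= 0` on `s ≥ 2L`), and the truncated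
  profiles `Rχ_L`, `R(1 − χ_L)`. -/
  set L : ℝ := K₁ ^ 2 with hL
  have hL0 : 0 < L := by positivity
  set χ : ℝ → ℝ := fun s => min 1 (max 0 (2 - s / L)) with hχ
  have hχlo : ∀ s, s ≤ L → χ s = 1 := cutoff_eq_one hL0 (χ := χ) fun s => by rw [hχ]
  obtain ⟨hχc, hχ0, hχ1, hχhi, -⟩ := cutoff_props hL0 (χ := χ) fun s => by rw [hχ]
  clear_value χ
  have hq : ∀ p s, 0 ≤ s → |(s - 5 * θ p - G (p, s)) * χ s| ≤ C_R * s := fun p s hs => by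
    rw [abs_mul, abs_of_nonneg (hχ0 s)]
    exact (mul_le_mul (hRbd p s hs) (hχ1 s) (hχ0 s) (by positivity)).trans (le_of_eq (mul_one _))
  have hqL : ∀ p s, 0 ≤ s → |(s - 5 * θ p - G (p, s)) * χ s| ≤ C_R * (2 * L) := fun p s hs => by
    by_cases h : s ≤ 2 * L
    · exact (hq p s hs).trans (mul_le_mul_of_nonneg_left h hC_R0)
    · rw [hχhi s (not_le.1 h).le, mul_zero, abs_zero]; positivity
  have hqt : ∀ p s, 0 ≤ s → |(s - 5 * θ p - G (p, s)) * (1 - χ s)| ≤ C_R * s := fun p s hs => by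
    rw [abs_mul, abs_of_nonneg (sub_nonneg.2 (hχ1 s))]
    exact (mul_le_mul (hRbd p s hs) (by linarith [hχ0 s]) (sub_nonneg.2 (hχ1 s))
      (by positivity)).trans (le_of_eq (mul_one _))
  have hlin : ∀ p s, 0 ≤ s → C_R * (θ p * s) ≤ C_R * θM * (1 + s) := fun p s hs => by
    calc C_R * (θ p * s) ≤ C_R * (θM * s) := by gcongr; exact hθM p
      _ = C_R * θM * s := by ring
      _ ≤ C_R * θM * (1 + s) := mul_le_mul_of_nonneg_left (by linarith) (by positivity)
  have hiRχ : ∀ p, Integrable (fun ξ : V3 => ξ 0 * ξ 0 *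
      ((θ p * ‖ξ‖ ^ 2 - 5 * θ p - G (p, θ p * ‖ξ‖ ^ 2)) * χ (θ p * ‖ξ‖ ^ 2))) (stdGaussian V3) :=
    fun p => integrable_coord_mul_weight 0 0
      (ω := fun t => (θ p * t - 5 * θ p - G (p, θ p * t)) * χ (θ p * t)) (by fun_prop)
      (P := C_R * θM) fun t ht => (hq p _ (mul_nonneg (hθpos p).le ht)).trans (hlin p t ht)
  have hiRt : ∀ p, Integrable (fun ξ : V3 => ξ 0 * ξ 0 *
      ((θ p * ‖ξ‖ ^ 2 - 5 * θ p - G (p, θ p * ‖ξ‖ ^ 2)) * (1 - χ (θ p * ‖ξ‖ ^ 2))))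
      (stdGaussian V3) :=
    fun p => integrable_coord_mul_weight 0 0
      (ω := fun t => (θ p * t - 5 * θ p - G (p, θ p * t)) * (1 - χ (θ p * t))) (by fun_prop)
      (P := C_R * θM) fun t ht => (hqt p _ (mul_nonneg (hθpos p).le ht)).trans (hlin p t ht)
  /- Step 5: the compensating amplitude `ρ = E[ξ₀² Rχ_L(θ‖ξ‖²)] / m₀` (continuous by dominated
  convergence); `‖b‖ |ρ|` is a Gaussian tail. -/
  obtain ⟨ρ, hρc, hρdef⟩ : ∃ ρ : X → ℝ, Continuous ρ ∧ ∀ p, ρ p = (∫ ξ, ξ 0 * ξ 0 *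
      ((θ p * ‖ξ‖ ^ 2 - 5 * θ p - G (p, θ p * ‖ξ‖ ^ 2)) * χ (θ p * ‖ξ‖ ^ 2)) ∂stdGaussian V3) /
        m₀ := by
    refine ⟨_, Continuous.div_const ?_ _, fun p => rfl⟩
    refine continuous_of_dominated
      (bound := fun ξ : V3 => 1 * 1 * (C_R * (2 * L)) * (1 + ‖ξ‖ ^ 2) ^ 3)
      (fun p => (by fun_prop : Continuous fun ξ : V3 => ξ 0 * ξ 0 *
        ((θ p * ‖ξ‖ ^ 2 - 5 * θ p - G (p, θ p * ‖ξ‖ ^ 2)) * χ (θ p * ‖ξ‖ ^ 2))).aestronglyMeasurable)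
      (fun p => ae_of_all _ fun ξ => ?_) (integrable_one_add_norm_sq_cube.const_mul _)
      (ae_of_all _ fun ξ => by fun_prop)
    rw [Real.norm_eq_abs]
    exact abs_mul_three_le (abs_coord_le' ξ 0) (abs_coord_le' ξ 0)
      (le_mul_one_add (hqL p _ (mul_nonneg (hθpos p).le (sq_nonneg _))) (by positivity)
        (sq_nonneg _))
  have hbρ : ∀ p, ‖b p‖ * |ρ p| ≤ Bb * Tt * Real.exp (-(a * L / θM)) / m₀ := by
    intro p
    have hsum : ∫ ξ, ξ 0 * ξ 0 * (θ p * ‖ξ‖ ^ 2 - 5 * θ p - G (p, θ p * ‖ξ‖ ^ 2)) ∂stdGaussian V3 =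
        ρ p * m₀ + ∫ ξ, ξ 0 * ξ 0 * ((θ p * ‖ξ‖ ^ 2 - 5 * θ p - G (p, θ p * ‖ξ‖ ^ 2)) *
          (1 - χ (θ p * ‖ξ‖ ^ 2))) ∂stdGaussian V3 := by
      rw [hρdef, div_mul_cancel₀ _ hm₀.ne', ← integral_add (hiRχ p) (hiRt p)]
      exact integral_congr_ae (ae_of_all _ fun ξ => by ring)
    have ht := htail p L (fun s => (s - 5 * θ p - G (p, s)) * (1 - χ s)) (fun s hs => hqt p s hs)
      (fun s hs => by simp only [hχlo s hs, sub_self, mul_zero])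
    have h := hbR p
    rw [hsum, mul_add, add_eq_zero_iff_eq_neg] at h
    rw [le_div_iff₀ hm₀]
    calc ‖b p‖ * |ρ p| * m₀ = |‖b p‖ * (ρ p * m₀)| := by
          rw [abs_mul, abs_mul, abs_of_nonneg (norm_nonneg _), abs_of_pos hm₀]; ring
      _ = ‖b p‖ * |∫ ξ, ξ 0 * ξ 0 * ((θ p * ‖ξ‖ ^ 2 - 5 * θ p - G (p, θ p * ‖ξ‖ ^ 2)) *
            (1 - χ (θ p * ‖ξ‖ ^ 2))) ∂stdGaussian V3| := by
          rw [h, abs_neg, abs_mul, abs_of_nonneg (norm_nonneg _)]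
      _ ≤ Bb * (Tt * Real.exp (-(a * L / θM))) := mul_le_mul (hBb p) ht (abs_nonneg _) hBb0
      _ = Bb * Tt * Real.exp (-(a * L / θM)) := by ring
  /- Step 6: the size of the correction `ρ (b·w) ω₀(|w|²/θ)` (vanishes for `|w|² ≥ S_ω = 2θM`). -/
  have hexp1 : Real.exp (-(a * L / θM)) ≤ 1 :=
    Real.exp_le_one_iff.2 (neg_nonpos.2 (by positivity))
  have hexpK : Real.exp (-(a * L / θM)) ≤ Real.exp (-(c * K₁)) := by
    rw [Real.exp_le_exp, neg_le_neg_iff, le_div_iff₀ hθM0, hL]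
    have h1 : c * θM ≤ K₁ * a := (div_le_iff₀ ha).1 hcK
    nlinarith [h1, hK₁0.le, hc.le]
  have hcorr : ∀ p (w : V3), |ρ p * (∑ j, b p j * w j) * ω₀ (‖w‖ ^ 2 / θ p)| ≤
      A * Real.exp (-(a * L / θM)) := by
    intro p w
    by_cases hw : S_ω ≤ ‖w‖ ^ 2
    · have h2 : (0 : ℝ) + 2 ≤ ‖w‖ ^ 2 / θ p := by
        rw [le_div_iff₀ (hθpos p)]
        calc (0 + 2) * θ p ≤ (0 + 2) * θM := mul_le_mul_of_nonneg_left (hθM p) (by norm_num)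
          _ ≤ ‖w‖ ^ 2 := hw
      rw [hω₀hi _ h2, mul_zero, abs_zero]; positivity
    · rw [abs_mul, abs_mul, abs_of_nonneg (hω₀0 _)]
      calc |ρ p| * |∑ j, b p j * w j| * ω₀ (‖w‖ ^ 2 / θ p)
          ≤ |ρ p| * (‖b p‖ * (1 + ‖w‖ ^ 2)) * 1 :=
            mul_le_mul (mul_le_mul_of_nonneg_left (abs_lin_le _ _) (abs_nonneg _)) (hω₀1 _)
              (hω₀0 _) (by positivity)
        _ = ‖b p‖ * |ρ p| * (1 + ‖w‖ ^ 2) := by ring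
        _ ≤ Bb * Tt * Real.exp (-(a * L / θM)) / m₀ * (1 + S_ω) :=
            mul_le_mul (hbρ p) (by linarith [not_le.1 hw]) (by positivity) (by positivity)
        _ = A * Real.exp (-(a * L / θM)) := by rw [hA]; ring
  /- Step 7: the profile `G_b` and its pointwise properties. -/
  obtain ⟨Gb, hGbc, hGbdef⟩ : ∃ Gb : X × ℝ → ℝ, Continuous Gb ∧
      ∀ p s, Gb (p, s) = (s - 5 * θ p - G (p, s)) * χ s - ρ p * ω₀ (s / θ p) := by
    have hd : Continuous fun q : X × ℝ => q.2 / θ q.1 :=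
      continuous_snd.div (hθc.comp continuous_fst) fun q => (hθpos q.1).ne'
    have h1 : Continuous fun q : X × ℝ => (q.2 - 5 * θ q.1 - G q) * χ q.2 := by fun_prop
    exact ⟨fun q => (q.2 - 5 * θ q.1 - G q) * χ q.2 - ρ q.1 * ω₀ (q.2 / θ q.1),
      h1.sub ((hρc.comp continuous_fst).mul (hω₀c.comp hd)), fun p s => rfl⟩
  set S₀ : ℝ := max (2 * L) S_ω with hS₀
  have hS₀0 : 0 ≤ S₀ := le_max_of_le_left (by positivity)
  have hGbhi : ∀ p s, S₀ ≤ s → Gb (p, s) = 0 := by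
    intro p s hs
    have h1 : 2 * L ≤ s := (le_max_left _ _).trans hs
    have h2 : (0 : ℝ) + 2 ≤ s / θ p := by
      rw [le_div_iff₀ (hθpos p)]
      calc (0 + 2) * θ p ≤ (0 + 2) * θM := mul_le_mul_of_nonneg_left (hθM p) (by norm_num)
        _ ≤ S₀ := le_max_right _ _
        _ ≤ s := hs
    rw [hGbdef, hχhi s h1, hω₀hi _ h2]; ring
  have hGbbd : ∀ p s, 0 ≤ s → |Gb (p, s)| ≤ C_R * (2 * L) + |ρ p| := by
    intro p s hs
    rw [hGbdef]
    refine (abs_sub _ _).trans (add_le_add (hqL p s hs) ?_)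
    rw [abs_mul]
    exact (mul_le_mul_of_nonneg_left (by rw [abs_of_nonneg (hω₀0 _)]; exact hω₀1 _)
      (abs_nonneg _)).trans (le_of_eq (mul_one _))
  /- Step 8: the scalar re-orthogonalisation identity `E[ξ₀² G_b(p, θ‖ξ‖²)] = ρ m₀ − ρ m₀ = 0` and
  the orthogonality of `(b·w) G_b` to `1, v_k, |v|²` (`odd_member_orth`). -/
  have hscalar : ∀ p, ∫ ξ : V3, ξ 0 * ξ 0 * Gb (p, θ p * ‖ξ‖ ^ 2) ∂stdGaussian V3 = 0 := by
    intro p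
    have hGsh : ∀ ξ : V3, ξ 0 * ξ 0 * Gb (p, θ p * ‖ξ‖ ^ 2) =
        ξ 0 * ξ 0 * ((θ p * ‖ξ‖ ^ 2 - 5 * θ p - G (p, θ p * ‖ξ‖ ^ 2)) * χ (θ p * ‖ξ‖ ^ 2)) -
          ρ p * (ξ 0 * ξ 0 * ω₀ (‖ξ‖ ^ 2)) := by
      intro ξ; rw [hGbdef, mul_div_cancel_left₀ _ (hθpos p).ne']; ring
    simp_rw [hGsh]
    rw [integral_sub (hiRχ p) (hiω₀.const_mul _), integral_const_mul, ← hm₀def, hρdef,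
      div_mul_cancel₀ _ hm₀.ne', sub_self]
  have horth := fun p => odd_member_orth (hθpos p) (u p) (b p) (Gx := fun s => Gb (p, s))
    (by fun_prop) (C := C_R * (2 * L) + |ρ p|) (fun s hs => hGbbd p s hs) hS₀0
    (fun s hs => hGbhi p s hs) (hscalar p)
  /- Step 9: the growth of `(b·w) G_b`: `|Rχ_L(|w|²)| ≤ C_R|w|² 1{|w| < 2K₁}`, `|b·w| ≤ Bb|w|`. -/
  have hgrowth : ∀ p (v : V3), |(∑ j, b p j * (v - u p) j) * Gb (p, ‖v - u p‖ ^ 2)| ≤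
      (4 * Bb * C_R * (1 + U ^ 2) + A + 1) * K₁ * (1 + ‖v‖ ^ 2) := by
    intro p v
    have e : (∑ j, b p j * (v - u p) j) * Gb (p, ‖v - u p‖ ^ 2) =
        (∑ j, b p j * (v - u p) j) *
            ((‖v - u p‖ ^ 2 - 5 * θ p - G (p, ‖v - u p‖ ^ 2)) * χ (‖v - u p‖ ^ 2)) -
          ρ p * (∑ j, b p j * (v - u p) j) * ω₀ (‖v - u p‖ ^ 2 / θ p) := by
      rw [hGbdef]; ring
    rw [e]
    have h1 : |(∑ j, b p j * (v - u p) j) *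
        ((‖v - u p‖ ^ 2 - 5 * θ p - G (p, ‖v - u p‖ ^ 2)) * χ (‖v - u p‖ ^ 2))| ≤
        2 * Bb * C_R * K₁ * ‖v - u p‖ ^ 2 := by
      by_cases hw : 2 * L ≤ ‖v - u p‖ ^ 2
      · rw [hχhi _ hw, mul_zero, mul_zero, abs_zero]; positivity
      · have h4 : ‖v - u p‖ ^ 2 < (2 * K₁) ^ 2 := by
          rw [hL] at hw; nlinarith [not_le.1 hw, sq_nonneg K₁]
        have hwK : ‖v - u p‖ < 2 * K₁ := lt_of_pow_lt_pow_left₀ 2 (by positivity) h4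
        rw [abs_mul]
        calc |∑ j, b p j * (v - u p) j| *
              |(‖v - u p‖ ^ 2 - 5 * θ p - G (p, ‖v - u p‖ ^ 2)) * χ (‖v - u p‖ ^ 2)|
            ≤ ‖b p‖ * ‖v - u p‖ * (C_R * ‖v - u p‖ ^ 2) :=
              mul_le_mul (abs_dot_le _ _) (hq p _ (sq_nonneg _)) (abs_nonneg _) (by positivity)
          _ ≤ Bb * (2 * K₁) * (C_R * ‖v - u p‖ ^ 2) := by gcongr; exact hBb p
          _ = 2 * Bb * C_R * K₁ * ‖v - u p‖ ^ 2 := by ring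
    have h2 : |ρ p * (∑ j, b p j * (v - u p) j) * ω₀ (‖v - u p‖ ^ 2 / θ p)| ≤ A :=
      (hcorr p _).trans (mul_le_of_le_one_right hA0 hexp1)
    have hw2 := norm_sub_sq_le (hU p) v
    have hw3 : ‖v‖ ^ 2 + U ^ 2 ≤ (1 + U ^ 2) * (1 + ‖v‖ ^ 2) := by
      nlinarith [mul_nonneg (sq_nonneg U) (sq_nonneg ‖v‖)]
    have h6 : A ≤ A * K₁ * (1 + ‖v‖ ^ 2) := by
      rw [mul_assoc]
      exact le_mul_of_one_le_right hA0
        (one_le_mul_of_one_le_of_one_le hK₁1 (by nlinarith [sq_nonneg ‖v‖]))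
    calc _ ≤ 2 * Bb * C_R * K₁ * ‖v - u p‖ ^ 2 + A := (abs_sub _ _).trans (add_le_add h1 h2)
      _ ≤ 2 * Bb * C_R * K₁ * (2 * ‖v‖ ^ 2 + 2 * U ^ 2) + A * K₁ * (1 + ‖v‖ ^ 2) :=
          add_le_add (mul_le_mul_of_nonneg_left hw2 (by positivity)) h6
      _ = 4 * Bb * C_R * K₁ * (‖v‖ ^ 2 + U ^ 2) + A * K₁ * (1 + ‖v‖ ^ 2) := by ring
      _ ≤ 4 * Bb * C_R * K₁ * ((1 + U ^ 2) * (1 + ‖v‖ ^ 2)) + A * K₁ * (1 + ‖v‖ ^ 2) +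
            1 * K₁ * (1 + ‖v‖ ^ 2) :=
          le_add_of_le_of_nonneg (add_le_add (mul_le_mul_of_nonneg_left hw3 (by positivity)) le_rfl)
            (by positivity)
      _ = (4 * Bb * C_R * (1 + U ^ 2) + A + 1) * K₁ * (1 + ‖v‖ ^ 2) := by ring
  /- Step 10: assembly. -/
  refine ⟨Gb, hGbc, ⟨(4 * Bb * C_R * (1 + U ^ 2) + A + 1) * K₁ * (1 + (2 * S₀ + 2 * U ^ 2)),
    fun p v => ?_⟩, hgrowth, fun p => (horth p).1, fun p k => (horth p).2.1 k, fun p => (horth p).2.2,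
    fun p v => ?_⟩
  · -- bounded: `G_b(p, |w|²) = 0` for `|w|² ≥ S₀`, and `|v|² ≤ 2S₀ + 2U²` below
    by_cases hw : S₀ ≤ ‖v - u p‖ ^ 2
    · rw [hGbhi p _ hw, mul_zero, abs_zero]; positivity
    · refine (hgrowth p v).trans ?_
      have h3 := norm_sq_le_of_sub (hU p) v
      gcongr
      linarith [not_le.1 hw]
  · -- the remainder `(b·w)R(1 − χ_L)(|w|²) + ρ (b·w) ω₀(|w|²/θ)`
    have e : (∑ j, b p j * (v - u p) j) * (‖v - u p‖ ^ 2 - 5 * θ p - G (p, ‖v - u p‖ ^ 2)) -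
          (∑ j, b p j * (v - u p) j) * Gb (p, ‖v - u p‖ ^ 2) =
        (∑ j, b p j * (v - u p) j) *
            ((‖v - u p‖ ^ 2 - 5 * θ p - G (p, ‖v - u p‖ ^ 2)) * (1 - χ (‖v - u p‖ ^ 2))) +
          ρ p * (∑ j, b p j * (v - u p) j) * ω₀ (‖v - u p‖ ^ 2 / θ p) := by
      rw [hGbdef]; ring
    rw [e]
    refine (abs_add_le _ _).trans (add_le_add ?_
      ((hcorr p _).trans (mul_le_mul_of_nonneg_left hexpK hA0)))
    by_cases hwL : ‖v - u p‖ ^ 2 ≤ L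
    · rw [hχlo _ hwL, sub_self, mul_zero, mul_zero, abs_zero]
      split_ifs <;> positivity
    · have hKw : K₁ < ‖v - u p‖ := by
        refine lt_of_pow_lt_pow_left₀ 2 (norm_nonneg _) ?_
        rw [← hL]; exact not_le.1 hwL
      rw [if_pos hKw, abs_mul]
      calc |∑ j, b p j * (v - u p) j| *
            |(‖v - u p‖ ^ 2 - 5 * θ p - G (p, ‖v - u p‖ ^ 2)) * (1 - χ (‖v - u p‖ ^ 2))|
          ≤ ‖b p‖ * ‖v - u p‖ * (C_R * ‖v - u p‖ ^ 2) :=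
            mul_le_mul (abs_dot_le _ _) (hqt p _ (sq_nonneg _)) (abs_nonneg _) (by positivity)
        _ ≤ Bb * ‖v - u p‖ * (C_R * ‖v - u p‖ ^ 2) := by gcongr; exact hBb p
        _ = Bb * C_R * ‖v - u p‖ ^ 3 := by ring

/-! ## The stub -/

/-- **`stub_bandShiftStatics`** (line `IdeatorOneSketch`, crux stmt-AtomisticToContinuum-9133): the
re-orthogonalised band truncation of the suprathermal heat-flux remainder along jointly continuous
families — `bandShift_param` over the parameter space `ℝ × 𝕋³` with `θ = uncurry θ`,
`u = uncurry u`, `b = uncurry b`, `G((s,x),s′) = G s (x,s′)`, re-curried. [cite: NachtergaeleYau2003, §5] -/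
theorem stub_bandShiftStatics : BandShiftStatics := by
  intro θ u b G θm θM U Bb C_G hθm0 hθmM _hU0 hBb0 hCG0 hθc _huc _hbc hGc hθm hθM hU hBb hGbd hGlo
    hGorth
  have hG' : Continuous fun q : (ℝ × T3) × ℝ => G q.1.1 (q.1.2, q.2) :=
    hGc.comp (f := fun q : (ℝ × T3) × ℝ => (q.1.1, (q.1.2, q.2))) (by fun_prop)
  obtain ⟨CB, hCB, H⟩ := bandShift_param (X := ℝ × T3) (θ := Function.uncurry θ) hθc
    (Function.uncurry u) (Function.uncurry b) (G := fun q : (ℝ × T3) × ℝ => G q.1.1 (q.1.2, q.2))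
    hG' hθm0 hθmM hBb0 hCG0 (fun p => hθm p.1 p.2) (fun p => hθM p.1 p.2)
    (fun p => hU p.1 p.2) (fun p => hBb p.1 p.2) (fun p s hs => hGbd p.1 (p.2, s) hs)
    (fun p s hs => hGlo p.1 p.2 s hs) (fun p k => hGorth p.1 p.2 k)
  refine ⟨CB, hCB, fun c hc => ?_⟩
  obtain ⟨A, hA, K₀, hK₀, HK⟩ := H c hc
  refine ⟨A, hA, K₀, hK₀, fun K₁ hK₁ => ?_⟩
  obtain ⟨Gb, hGbc, ⟨M, hM⟩, hgr, h0, h1, h2, hrem⟩ := HK K₁ hK₁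
  refine ⟨fun s y => Gb ((s, y.1), y.2), ?_, ⟨M, fun s y => hM (s, y.1) y.2⟩,
    fun s y => hgr (s, y.1) y.2, fun s x => h0 (s, x), fun s x k => h1 (s, x) k,
    fun s x => h2 (s, x), fun s y => hrem (s, y.1) y.2⟩
  show Continuous fun q : ℝ × (T3 × ℝ) => Gb ((q.1, q.2.1), q.2.2)
  fun_prop

end Summit.AtomisticToContinuum.HydrodynamicLimit.Theorems.HydroLimitInBandBandShift

end
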